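import Mathlib
import HarnessLib
import HarnessLib.Audit
import Summits.AtomisticToContinuum.Statement
import Literature.MathematicalPhysics.QuantumManyBody.PeriodicBoseGas
import Literature.Barriers.AtomisticToContinuum.BogoliubovPerturbationInfrared
import HarnessLib.Audit.Status.Attr

/-!
Route: BECDispersionLadder

DORMANT since 2026-08-29T19:25:39Z (census g0: costume|duplicate of —; reader census-reader-31-g0) — unstaffed, not closed; items shared with open routes are served there. `ledger route dormant <id> --off` reactivates.

# Route BECDispersionLadder — kinetic-exponent dial — uniform BEC for (−Δ)^{α/2} as α↑2, then energy
comparison at the marginal endpoint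

It suffices to show X = UNIFORM DIAL CONDENSATION (item Target): for every repulsive finite-range
radial v there is ρ₀ > 0 such that
for 0 < ρ < ρ₀ there are a kinetic-exponent window (α₀, 2) (α₀ < 2 depending on v, ρ only) and c > 0
with: for all large N there is
ONE slack δ > 0 such that for EVERY α ∈ (α₀, 2), every periodic trial state Ψ on the torus of side L
= (N/ρ)^{1/3} with
E_α(Ψ) ≤ inf E_α + δ has constant-mode occupation ≥ c·N, where E_α(Ψ) = Σ_{p∈ℤ³} |2πp/L|^α n_Ψ(p) +
∫_{cell^N} Σ_{i<j} v^per(xᵢ−xⱼ)|Ψ|²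
is the quadratic form of Σᵢ(−Δᵢ)^{α/2} + V on the torus written through plane-wave occupations
n_Ψ(p) (typed today over
Literature.BoseGas / PeriodicBoseGas, no new definition). In words: the α-regularised d = 3 dilute
gases, strictly on the infrared-CONVERGENT
side of the catalogued marginality (one-loop bubble finite iff α < 2; item DialPowerCounting),
condense uniformly as α ↑ 2 — c, δ and the
N-threshold independent of α on a fixed window. Realises card above-dc-dials, dial (A) (the d-dial
is not typable: Space = ℝ³ is fixed by
the conjunct), as the conforming successor of route BECDispersionDial (retired 2026-08-15
`not-a-thesis` for form only: its Assembly named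
the Literature constant instead of the Statement decl), with two statement repairs recorded under §
Why this line. Ladder: OpenSideBEC
(each fixed α) → DialUniformity (⇒ X, the marginal logarithm as regulator-uniformity) →
EndpointTransfer (X ⇒ periodic BEC at fixed N by
ENERGY COMPARISON) → BoundaryTransferWeak (shared stmt-0827) → BoseEinsteinCondensation; deciding
theorem
`closes : Target → EndpointTransfer → BoundaryTransferWeak → _root_.BoseEinsteinCondensation` (rc 0,
axioms propext/Classical.choice/Quot.sound).
Lean: `∀ v : ℝ → ENNReal,
Literature.MathematicalPhysics.QuantumManyBody.BoseGas.IsRepulsiveFiniteRange v → ∃ ρ₀ : ℝ, 0 < ρ₀ ∧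
∀ ρ : ℝ, 0 < ρ → ρ < ρ₀ → ∃ α₀ : ℝ, α₀ < 2 ∧ ∃ c : ℝ, 0 < c ∧ ∀ᶠ N : ℕ in Filter.atTop, ∃ δ :
ENNReal, 0 < δ ∧ ∀ α : ℝ, α₀ < α → α < 2 → ∀ Ψ :
Literature.MathematicalPhysics.QuantumManyBody.BoseGas.PeriodicTrialState N
(Literature.MathematicalPhysics.QuantumManyBody.BoseGas.sideLength ρ N), (let L : ℝ :=
Literature.MathematicalPhysics.QuantumManyBody.BoseGas.sideLength ρ N; let E :
(Literature.MathematicalPhysics.QuantumManyBody.BoseGas.Config N → ℂ) → ENNReal := fun ψ => (∑' p :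
Fin 3 → ℤ, ENNReal.ofReal ((2 * Real.pi / L * Real.sqrt (∑ k : Fin 3, ((p k : ℤ) : ℝ) ^ 2)) ^ α) *
Literature.MathematicalPhysics.QuantumManyBody.BoseGas.cellOccupation N L (fun x : EuclideanSpace ℝ
(Fin 3) => ((Real.sqrt (L ^ 3))⁻¹ : ℂ) * Complex.exp (2 * Real.pi * Complex.I * ((∑ k : Fin 3, ((p k
: ℤ) : ℝ) * x k : ℝ) : ℂ) / (L : ℂ))) ψ) + ∫⁻ X in
Literature.MathematicalPhysics.QuantumManyBody.BoseGas.cellN N L,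
Literature.MathematicalPhysics.QuantumManyBody.BoseGas.periodicInteraction v L X * (‖ψ X‖₊ :
ENNReal) ^ 2; E Ψ.ψ ≤ (⨅ Φ :
Literature.MathematicalPhysics.QuantumManyBody.BoseGas.PeriodicTrialState N L, E Φ.ψ) + δ) →
ENNReal.ofReal (c * N) ≤ Literature.MathematicalPhysics.QuantumManyBody.BoseGas.condensateOccupation
N (Literature.MathematicalPhysics.QuantumManyBody.BoseGas.sideLength ρ N) Ψ.ψ`

## Assembly
Pure logic, proved sorry-free in Sketch.lean (`closes`, and `assembly_holds : Assembly`): fix v;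
Target gives ρ₀ and, for ρ < ρ₀, a window
(α₀,2), c > 0 and for eventually all N (where also 0 < sideLength ρ N, by Real.rpow_pos_of_pos) one
slack δ with uniform-in-α condensation at
(N, L = sideLength ρ N); EndpointTransfer turns this into δ'-near-minimiser condensation for
periodicEnergy with the same c, i.e. the
hypothesis PeriodicBEC(v) of BoundaryTransferWeak, which yields ∃ρ₀ ∀ρ∈(0,ρ₀) HasGroundStateBEC v ρ
— the conjunct, concluded BY NAME as
`_root_.BoseEinsteinCondensation`. The deciding theorem is `closes : Target → EndpointTransfer →
BoundaryTransferWeak → BoseEinsteinCondensation`;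
the Assembly item records the full ladder (DialUniformity applied to OpenSideBEC is Target) and is
provable now by the same term.

Rationale: WHY THIS LINE. The conjunct sits exactly at the marginal point of the T = 0 infrared power counting
— the Gavoret–Nozières bubble of two phonon-pole
propagators is log-divergent iff d + 1 = 4 (barrier BogoliubovPerturbationInfrared, PROVED in tree;
Benfatto1994 §1,§3, CastellaniEtAl1997,
PistolesiEtAl2004, DupuisRancon2011 §2.2) — and replacing −Δ by (−Δ)^{α/2} moves the SAME d = 3
continuum gas with the same v strictly to the
convergent side (dynamic exponent z = α/2, bubble finite iff d > 3α/2) while keeping what every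
non-perturbative tool needs: a
positivity-preserving free semigroup (α-stable subordination of the heat kernel: Feynman–Kac,
Perron–Frobenius, reflection positivity in
time), translation and U(1) invariance, and v ≥ 0 untouched. This is the fractional-covariance dial
of FisherMaNickel1972 made rigorous for
CLASSICAL models by BrydgesMitterScoppola2003 (arXiv:hep-th/0206040 §1.1), Slade2017
(arXiv:1611.06169) / LohmannSladeWallace2017 (long-range
O(n), d_c = 2α, d = d_c − ε) and ChenSakai2015 / ChenSakai2019, transplanted with an explicit
dictionary: long-range coupling r^{-(d+α)} ↦ free dispersion
|k|^α; d_c = 2α ↦ d_c = 3α/2; "ε-expansion below d_c" ↦ "uniform bounds from above the marginal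
point, then ε = 2 − α → 0". On the open side the
symmetry-broken infrared regime at which the Balaban–Feldman–Knörrer–Trubowitz programme stops
(BalabanEtAl2010, BFKT2017) carries only
power-counting-irrelevant couplings — the situation in which Balaban constructed ordered phases of
classical N-vector models with large fields
and without reflection positivity (Balaban1995, BalabanOcarroll1999) — so OpenSideBEC isolates the
large-field / complex-measure problem from
the marginal flow, DialUniformity is the marginal logarithm posed in a symmetry-preserving regulator
(Ward identities hold at every α), and
EndpointTransfer is fixed-volume Γ-convergence (Dalmaso1993 Ch. 7, DinezzaPalatucciValdinoci2012,
Kato1966). Areas imported: constructive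
renormalisation, rigorous RG for long-range models (the α-dial), Γ-convergence / spectral
perturbation theory. Two repairs w.r.t. the retired
predecessor: (i) the slack δ in X is uniform in α (chosen after N, before α) — natural for
thermodynamic-limit proofs (δ ∝ energy scale × N)
and exactly what lets the endpoint be reached by energy comparison; (ii) the old EndpointTransfer
(δ_α-dependent hypothesis ⇒ c/2 via
ground-state uniqueness) is FALSE at tuned degeneracy (N = 2, hard shell v = ⊤·1_[r₁,r₂], side L*
where the in-shell and out-of-shell
ground energies cross: for α < 2 the nonlocal form couples the two components, the ground state is
unique and positive, so the hypothesis
holds with a small c, while at α = 2 the two-dimensional ground space contains ψ_in − εψ_out with n₀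
≈ 0); the new EndpointTransfer needs no
uniqueness: E_α ≤ E_2 + N·max_{0<k<1}(k^α − k²) (items OccupationSumRule, FracEnergyAtTwo) and
liminf_{α→2⁻} inf E_α ≥ inf E_2. What
prior/open routes do not do: the retired BECRenormGroup attacked (3,2) head-on with informal items;
BECPeriodicReduction (retired) isolated
PeriodicBEC ("any method"); none of the 22 open BEC routes (scanned 2026-08-15) varies the
dispersion; the lace/renewal engine of the card is
NOT adopted (BolthausenKoenigMukherjee2024 arXiv:2405.08753 certifies cycle mass / symmetric-phase
decay, not ODLRO — novelty audit AUDIT-37);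
nothing in the negatives index (6 entries, one BEC: SwapJensen) is touched.

RANKED CRUXES. #0 Target (target) — X = UNIFORM DIAL CONDENSATION as in § Thesis: for every
admissible v, small ρ, a fixed window (α₀,2) and c > 0 (depending on v, ρ only), for all large N one
slack δ > 0 such that for every α in the window all δ-near-minimisers of E_α on the torus of side
(N/ρ)^{1/3} have constant-mode occupation ≥ cN. (why it might fail: Uniformity in α re-imports the
d=3 marginal logarithm: constants from a strictly irrelevant flow degrade like (2−α)^{-1}, so
α-uniform c, δ and N-threshold on a fixed window (α₀,2) need the Ward-identity cancellations
themselves — possibly no easier than PeriodicBEC.) [Benfatto1994, PistolesiEtAl2004, Slade2017,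
BrydgesMitterScoppola2003, Literature.Barriers.AtomisticToContinuum.BogoliubovPerturbationInfrared]
#2 OpenSideBEC (crux) — rung 1 (card item (3) re-aimed per audit): for every FIXED kinetic exponent
1 < α < 2 and every repulsive finite-range radial v there is ρ₀ > 0 such that for 0 < ρ < ρ₀ there
is c > 0 with: for all large N there is δ > 0 such that every periodic trial state on the torus of
side L = (N/ρ)^{1/3} with E_α(Ψ) ≤ inf E_α + δ has condensateOccupation ≥ cN (E_α = Σ_p |2πp/L|^α
n_Ψ(p) + periodic interaction, inlined) — thermodynamic-limit ground-state BEC of the d = 3 dilute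
gas with dispersion |k|^α, strictly inside the infrared-convergent regime d > 3α/2. [difficulty:
open-problem] (why it might fail: Even with an irrelevant infrared flow no ordered
continuous-symmetry phase of a quantum Bose gas has been constructed: the large-field /
complex-Gaussian-measure obstruction (BFKT2017, Benfatto1994 §1) is α-independent; hard cores v=⊤
are admissible and c must be uniform in N.) [BFKT2017, BalabanEtAl2010, Balaban1995,
BalabanOcarroll1999, Benfatto1994, CenatiempoGiuliani2014, Fournais2020,
LiebSeiringerSolovejYngvason2005, Aaen2014]
#3 DialUniformity (crux) — rung 2, "attack the log": OpenSideBEC (for all α ∈ (1,2)) implies X — the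
condensation constants of the α-regularised gases can be chosen uniformly as α ↑ 2: for each small ρ
a fixed window (α₀,2) with c, the slack δ (per N) and the N-threshold independent of α. The marginal
(3,2) infrared problem posed as uniformity in a symmetry- and positivity-preserving analytic
regulator. [deps: OpenSideBEC] [difficulty: open-problem] (why it might fail: The implication may be
no easier than its conclusion: nothing known makes condensate bounds monotone or continuous in α
uniformly in N, and the only cure for the marginal flow (Ward identities / asymptotic freedom:
Benfatto1994 §3, PistolesiEtAl2004 §IV) is order-by-order with n! bounds.) [Benfatto1994,
CastellaniEtAl1997, PistolesiEtAl2004, DupuisRancon2011, ChenSakai2019,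
BauerschmidtBrydgesSlade2015LogCorr, LohmannSladeWallace2017]
#4 EndpointTransfer (crux) — rung 3, the endpoint at FIXED volume by energy comparison (repaired):
for every admissible v, N, L > 0, c > 0, α₀ < 2 and slack δ > 0, if for every α ∈ (α₀,2) all
δ-near-minimisers of E_α on the torus of side L have condensateOccupation ≥ cN, then for some δ' > 0
all δ'-near-minimisers of the ordinary periodicEnergy have condensateOccupation ≥ cN (same c).
Mechanism: E_α(Ψ) ≤ E_2(Ψ) + N·max_{0<k<1}(k^α−k²) (|k|^α ≤ |k|² for |k| ≥ 1, Σ_p n_Ψ(p) = N) and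
liminf_{α→2⁻} inf E_α ≥ inf E_2 (Γ-liminf with Rellich compactness in H^{α₀/2} of the 3N-torus), so
a δ/3-near-minimiser of E_2 is a δ-near-minimiser of E_α for α close to 2; no ground-state
uniqueness is used. [difficulty: L] (why it might fail: Needs liminf_{α→2⁻} inf E_α ≥ inf E_2 at
fixed (N,L): Γ-liminf + Rellich in H^{α₀/2}, AND energy-density of C¹ periodic states in the H¹ form
domain {∫V|Φ|²<∞}; for v with irregular ⊤-sets (fat Cantor shells) the C¹ infimum may exceed the
relaxed one and the transfer can fail.) [Dalmaso1993, DinezzaPalatucciValdinoci2012, Hedberg1981,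
Kato1966, ReedSimonIV1978, Fournais2020]
#5 BoundaryTransferWeak (crux) — shared verbatim with routes BECPeriodicReduction /
BECInfDivCoherence (item stmt-AtomisticToContinuum-0827): for each repulsive finite-range v,
PeriodicBEC(v) (constant-mode condensation of near-minimisers of periodicEnergy on the torus of side
(N/ρ)^{1/3} for all small ρ) implies ∃ρ₀>0 ∀ρ∈(0,ρ₀) HasGroundStateBEC v ρ (the conjunct's
Dirichlet, mode-free criterion). Not glue: near-minimiser slacks are O(N/L²) while
Dirichlet/periodic energies differ by a boundary term ≫ N/L²; expected route: Neumann bracketing of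
interior sub-boxes + a mode-free criterion (λ_max ≥ tr γ²/N). [difficulty: L] (why it might fail:
PeriodicBEC(v) is ground-state-only (δ after N): the Dirichlet ground state lies a wall term ≫ δ
above E₀^per and interior restrictions are neither periodic nor of sharp N, so the hypothesis may
never fire; BEC is boundary-condition-sensitive (Robinson1976).) [LiebSeiringerSolovejYngvason2005,
Basti2022, BoccatoSeiringer2023, Junge2026, Robinson1976, LauwersVerbeureZagrebnov2003]
#9 FracEnergyAtTwo (support) — consistency of the inlined α-energy with the library at the endpoint:
for α = 2 and every periodic trial state Ψ on a torus of side L > 0, E_2(Ψ) = periodicEnergy v Ψ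
(Parseval for ∇Ψ on the 3-torus in the traced variable, Tonelli, Bose symmetry: Σ_p |2πp/L|² n_Ψ(p)
= ∫_{cell^N} Σᵢ|∇ᵢΨ|²). [difficulty: M] [LiebSeiringerSolovejYngvason2005, Fournais2020]
#9 OccupationSumRule (support) — the plane-wave occupations of a periodic trial state sum to N:
Σ_{p∈ℤ³} n_Ψ(p) = N for every periodic trial state on a torus of side L > 0 (Parseval in the traced
variable: the plane waves L^{-3/2}e^{2πip·x/L} are an orthonormal basis of L²(cell), tr γ_Ψ = N) —
the input of EndpointTransfer's comparison E_α ≤ E_2 + N·max_{0<k<1}(k^α − k²). [difficulty: M]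
[LiebSeiringerSolovejYngvason2005, Fournais2020]
#9 DialPowerCounting (support) — the marginality certificate of the card (deliverable (ii)) in the
barrier's own vocabulary (FreqMomentum 3, spatialSq): for every α > 0 the one-loop bubble of two
dial propagators 1/(k₀² + |𝐤|^α), i.e. ((k₀² + (|𝐤|²)^{α/2})⁻¹)², is integrable on the unit infrared
ball of ℝ^{1+3} iff α < 2 (k₀-integral ≍ |𝐤|^{-3α/2}, then ∫₀¹ q^{2−3α/2}dq). α = 2 is the
catalogued log divergence (not_integrableOn_bubbleIntegrand, d = 3); α < 2 is the open side.
[difficulty: provable-now] [Literature.Barriers.AtomisticToContinuum.BogoliubovPerturbationInfrared,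
DupuisRancon2011, FisherMaNickel1972]

TWO-LAYER PLAN. Foreseen glued splits (none filed now; k ≤ 3, depth 1): OpenSideBEC ⇐
FracEnergyAsymptotics (Lieb–Yngvason / LHY-order energy bounds for
dispersion |k|^α with the Riesz scattering length of (−Δ)^{α/2} + v/2, the inputs of any multiscale
scheme) → SmallFieldDialFlow (BFKT
temporal-UV + parabolic + symmetry-broken regimes with strictly irrelevant couplings at fixed α < 2,
uniform in L) → LargeFieldDomination →
OpenSideBEC. DialUniformity ⇐ WardIdentityUniformity (α-uniform bounds on the running couplings via
the U(1) Ward identities, Benfatto /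
Pistolesi scheme in the regulated family) → DepletionUniformity (the depletion, unlike the
longitudinal self-energy, has an α-uniform bound) →
DialUniformity. EndpointTransfer ⇐ GroundEnergyContinuity (liminf_{α→2⁻} inf E_α ≥ inf E_2 at fixed
N, L: Γ-liminf termwise in Fourier
space by Fatou after Rellich, plus C¹ energy-density for the given v) → DialEnergyComparison (E_α ≤
E_2 + N·max_{0<k<1}(k^α−k²), from
OccupationSumRule and FracEnergyAtTwo) → EndpointTransfer (glue: pick α with both errors ≤ δ/3).

KILL CRITERIA. ¬OpenSideBEC for some α ∈ (1,2), some admissible v, at arbitrarily small ρ closes the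
route outright (close --reason refuted:OpenSideBEC): the
open side is not easier and the card's diagnosis "only the log is hard" is wrong — hand the witness
to the constructive-RG cards as evidence
that the large-field problem is the summit. ¬Target with OpenSideBEC standing (constants provably
blow up as α ↑ 2 on every fixed window, e.g.
an α-uniform lower bound on the depletion exceeding (1−c)N) refutes DialUniformity: pivot to
N-dependent windows α₀(N) ↑ 2 with quantified
rates (a different, weaker thesis) or close. ¬EndpointTransfer can only come from a v whose ⊤-set
defeats C¹ energy-density or from a failure
of inf E_α → inf E_2: repair by restating for v with {v = ⊤} a finite union of intervals (misstated,
not substantive). ¬BoundaryTransferWeak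
kills this route together with every PeriodicBEC-based route, not the conjunct. PeriodicBEC(v)
proved by any other route moots rungs 1–3
(close superseded, keep DialPowerCounting as the marginality certificate).

NOT DECOMPOSED YET. The d-dial (d ≥ 4 with −Δ; energy side known, Aaen2014): not typable while
Literature.BoseGas fixes Space = ℝ³, and it does not assemble to
d = 3 — left as a Literature-level sibling. The energy asymptotics on the open side (scattering
length for (−Δ)^{α/2} + v/2 = a Riesz
capacity; Dyson / Lieb–Yngvason bounds for |k|^α), the functional-integral representation and every
regime of the multiscale expansion
(layer-2 children of OpenSideBEC, above); the precise α-dependence of constants (children of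
DialUniformity); GroundEnergyContinuity and the
C¹-density lemma (children of EndpointTransfer; for hard spheres / shells {v = ⊤} is a finite union
of intervals and density is standard,
for general measurable v it is Hedberg-type spectral synthesis and may need the item restated);
finiteness of inf E_α at low density with
hard cores (prover obligation inside OpenSideBEC, as for PeriodicBEC); positive temperature; the
lace / renewal expansion of the card
(dropped per audits 14/29/37: BolthausenKoenigMukherjee2024 certifies cycle-mass loss at T > 0 in d
≥ 5, not an ordered phase).

CHEAPEST FALSIFIER. Two one-page checks, both favourable when done by hand here: (1) dial power
counting — with dispersion |k|^α the Bogoliubov mode is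
ω ≍ |k|^{α/2}: the one-loop bubble ∫dω d³k (ω² + k^α)^{-2} ≍ ∫ k^{2−3α/2} dk converges iff α < 2,
while the T = 0 depletion integrand
n_k ≍ k^{-α/2} and the phase fluctuations ⟨θθ⟩_k ≍ k^{-α/2} stay integrable in d = 3 for every α >
0: the open side is infrared-finite WITH
condensate (filed as the provable item DialPowerCounting); (2) the repaired endpoint consumes ONE α
near 2 per N (errors N·max_{k<1}(k^α−k²)
≤ N(2−α)/(eα) and inf E_2 − inf E_α → 0⁺). Killer: for some admissible v and N → ∞ at fixed small ρ,
near-minimisers of E_α (α in a fixed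
window) with n₀ ≤ (1−c′)N for every c′ refutes Target; the obvious candidate does NOT do it
(checked): the Pitaevskii–Stringari bound
n_k ≥ n₀/(4S(k)) − ½ with S(k) ≍ k^{α/2} gives an integrable k^{−α/2} tail in d = 3 for every α.
Lookup falsifier: a paper constructing T = 0
BEC for a fractional / long-range-hopping continuum Bose gas would make OpenSideBEC `known`
(searched 2026-08-15: none).

NUMBERS. Power counting (DupuisRancon2011 §2.2; barrier file, Narrowing block): bubble critical
dimension d_c = 3 for s = 0 vertices, 3 − s with
vertex weight s; with the dial d_c(α) = 3α/2, i.e. ε := 2 − α > 0 is the distance above marginality;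
max_{0<k<1}(k^α − k²) ≤ (2−α)/(e·α)
(comparison error per particle in EndpointTransfer, units k = 1). Expected depletion at α = 2: 1 −
n₀/N ≈ (8/3√π)√(ρa³)
(LiebSeiringerSolovejYngvason2005 App. A); state of the art without the dial: BEC on periodic boxes
L ≲ (ρa)^{-1/2}(ρa³)^{-δ} (Fournais2020
Thm 1.2), Neumann boxes up to a(ρa³)^{-3/4-η} (Junge2026 Cor. 6), kinetic localization / propagation
of condensation arXiv:2510.20493,
arXiv:2603.20776 (frontier 2026-08-15). Items at open: 9 (target, 4 cruxes, 3 support, assembly).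
CONE (route-repair 2026-08-15, unit rrepair-…-BECDisper-7cb6fe81): the route's module import cone
carries exactly four named facts, all from the vocabulary file PeriodicBoseGas.lean —
BoseGas.Fournais2020_condensation, LSSY2005_lowerBound_periodic, LSSY2005_lowerBound_dirichlet,
LSSY2005_upperBound_periodic; NONE is referenced by any item (the items use only PeriodicTrialState
/ cellOccupation / condensateOccupation / cellN / periodicInteraction / periodicEnergy /
periodicGroundStateEnergy, so the import cannot be dropped) and ALL FOUR are discharged
kernel-closed in-tree (LSSY2005_lowerBound_dirichlet_holds, LSSY2005_lowerBound_periodic_holds in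
LiebYngvasonTheorem.lean; LSSY2005_upperBound_periodic_holds in
PeriodicBoseGasUpperBoundProofs.lean; Fournais2020_condensation_holds in
PeriodicBoseGasCondensationHolds.lean; conjunction re-checked with `lean check --axioms` 2026-08-15:
propext, Classical.choice, Quot.sound). Gate-native dependency cone: 0 unproved of 40 project
constants, deciding theorem OK, staffable. needs-fact: none.

DEFINITION REQUESTS. None blocking (everything is inlined over Literature.BoseGas / PeriodicBoseGas
/ the barrier's FreqMomentum). Wanted for readability, to be
filed after open as definition items for Literature/MathematicalPhysics/QuantumManyBody:
`planeWaveMode L p` (L^{-3/2}e^{2πip·x/L} on the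
cell) and `fracPeriodicEnergy α v N L ψ` (= the inlined E_α); a tenure pass may then restate the
items over them (same normalised content). LANDED 2026-08-15
(Literature/MathematicalPhysics/QuantumManyBody/PeriodicBoseGasFracEnergy.lean,
defn-fracPeriodicEnergy): planeWaveMode, fracDispersion, fracPeriodicEnergy (= the inlined E_α
definitionally: fracPeriodicEnergy_eq_inline, rfl), fracPeriodicGroundStateEnergy, with
fracPeriodicEnergy_two (item FracEnergyAtTwo: 2-line proof attached as evidence to
stmt-AtomisticToContinuum-14558), PeriodicTrialState.tsum_cellOccupation_planeWaveMode (item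
OccupationSumRule: evidence on stmt-AtomisticToContinuum-14559), fracPeriodicEnergy_le_add_two and
limsup_fracPeriodicGroundStateEnergy_le (the comparison half of EndpointTransfer). The items are
deliberately NOT restated over these and the module is NOT imported by this route file (it sits on
the Fournais Thm 3.1 proof stack, whose intermediate named facts would enter the route's module
cone); provers import it in their Theorems files.

Novelty: Searches (2026-08-15, this seat): `lit frontier AtomisticToContinuum --since 2024` (30 rows; BEC
descendants arXiv:2510.20493,
arXiv:2603.20776, arXiv:2602.16566, arXiv:2605.06844 — none with a dispersion/dimension dial); `lit
bridges AtomisticToContinuum --cross any`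
(30 rows; no Bose-gas × long-range / lace bridge); `lit search --source crossref "fractional
Laplacian Bose gas condensation interacting"`
(10: textbooks, T_c-shift papers, Kreisel–Hasselmann–Kopietz PRL 98 (2007) on anomalous longitudinal
fluctuations — the IR anomaly, no dial);
`lit search --source crossref "semi-relativistic Bose gas dilute ground state energy scattering
length"` (10: Yin 2009, Lee–Yin 2010,
Lieb–Yngvason 2001 — all α = 2); `lit search --source zbmath "Bose gas fractional Laplacian ground
state energy dilute"` (0);
`lit galaxy search "fractional Laplacian Bose gas" / "fractional Bose gas" / "Bose gas with
fractional" --star all|pdf` (0/0/0 rows; control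
query "dilute Bose gas" --star pdf returns 5); local searchd and OpenAlex were unavailable (rc 75 /
HTTP 429) in this pass; gen-1 seat
(2026-08-15 a.m.): `lit search --hybrid "long-range fractional Laplacian dilute Bose gas
condensation zero temperature"` (10 books, textbooks
only), `lit vsearch "BEC of interacting bosons with fractional kinetic energy |k|^alpha"` (10,
textbooks only), crossref ×4, `lit read
arXiv:1611.06169 pp.1-2`, `arXiv:hep-th/0206040 p.1`; in-tree: barrier
BogoliubovPerturbationInfrared (+Narrow) read in full, the 22 open  [refs: 2510.20493, 2603.20776, 2602.16566, 2605.06844, 1611.06169, hep-th/0206040, 1204.1180, 1808.06789, 2405.08753, 1401.5960, BrydgesMitterScoppola2003, Slade2017, LohmannSladeWallace2017, ChenSakai2015, ChenSakai2019, Benfatto1994, CastellaniEtAl1997, PistolesiEtAl2004, BolthausenKoenigMukherjee2024, Aaen2014]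

Barriers (technique_class: fractional-kinetic-dial, continuity-method, constructive-rg): - technique_class: fractional-kinetic-dial, continuity-method, constructive-rg
- Literature.Barriers.AtomisticToContinuum.BogoliubovPerturbationInfrared: met head-on and turned
into a coordinate: the barrier's own typed (proved) content says the bubble converges iff the
effective dimension exceeds the marginal one; the dial puts every rung-1 model strictly on the
convergent side (DialPowerCounting) and confines the marginal logarithm to ONE item
(DialUniformity), where the bet is the barrier's recorded evasion (Ward identities / phase–amplitude
parametrisation; Narrowing block: s = 2 vertices are finite in d = 3) organised uniformly in the
regulator; it does not evade the large-field half of the barrier's text (BFKT2017) — that is rung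
1's open content, conceded.
- Literature.Barriers.AtomisticToContinuum.KineticGapLengthScales: applies to any proof of
OpenSideBEC that localises into boxes and pays ℓ^{-α} gaps — not used: rung 1 is a
thermodynamic-limit multiscale statement, and EndpointTransfer works at the FIXED final volume where
N-dependent slacks are allowed (δ, δ' depend on N) and no gap is invoked at all (energy comparison,
not spectral stability).
- Literature.Barriers.AtomisticToContinuum.EnergyAsymptoticsWithoutCondensation: energies enter only
as inputs (scattering data of (−Δ)^{α/2}+v/2) and through the comparison inf E_α ↔ inf E_2 at fixed
N; no item infers BEC from energy asymptotics — condensation is always transported from the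
α-hypothesis, never deduced from

History (route lifecycle, newest last):
- 2026-08-16T03:43:15Z · AUTO-CRUX (backfill): Target — hypotheses of the deciding theorem that nothing in the route derives are cruxes (operator:999:586464)
- 2026-08-24T23:52:25Z · DORMANT — reconciler: no traction for 7.2 d (last activity item-evidence-added at 2026-08-17T18:55:01Z); parked, not closed — `ledger route dormant route-AtomisticToConti (operator:999:1751828)
- 2026-08-29T03:16:54Z · REACTIVATED — reconciler: reactivated — activity statement-checked at 2026-08-29T01:17:37Z after parking at 2026-08-24T23:52:25Z (operator:999:3569976)
- 2026-08-29T19:25:39Z · DORMANT — census g0: costume|duplicate of —; reader census-reader-31-g0 (operator:999:790692)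

sub-problem: BoseEinsteinCondensation · status: dormant · opened planner-plancard-AtomisticToContinuum-BoseEin-be3443ba-g2-0 2026-08-15T19:09:38Z · rev 9 · ledger route-AtomisticToContinuum-BECDispersionLadder
GENERATED by the gate from the ledger (D-0016/17). Provers cite these decls: `theorem foo : Summit.AtomisticToContinuum.BoseEinsteinCondensation.Theses.BECDispersionLadder.<Decl> := …` in Summits/AtomisticToContinuum/BoseEinsteinCondensation/Theorems/<Name>.lean.
-/

namespace Summit.AtomisticToContinuum.BoseEinsteinCondensation.Theses.BECDispersionLadder

open scoped BigOperators Topology Manifold Classical MeasureTheory ProbabilityTheory Matrix InnerProductSpace ComplexConjugate ContinuousMap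
open Filter Set Function TopologicalSpace MeasureTheory

attribute [summit_statement] _root_.BoseEinsteinCondensation

/-- item stmt-AtomisticToContinuum-14554 · crux (kind.auto-crux: conjecture-grade) · rank 0 · open · by planner
why it might fail: Uniformity in α re-imports the d=3 marginal logarithm: bounds won from a (2−α)-irrelevant flow degrade like (2−α)^{-1} or exp(C/(2−α)), so ONE window (α₀,2) with α-uniform c, δ(N), N₀ needs the endpoint's own Ward-identity cancellations; X can fail even if every fixed-α gas condenses.
sources: Benfatto1994, PistolesiEtAl2004, DupuisRancon2011, Slade2017, Literature.Barriers.AtomisticToContinuum.BogoliubovPerturbationInfrared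
[target] X = UNIFORM DIAL CONDENSATION as in § Thesis: for every admissible v, small ρ, a fixed
window (α₀,2) and c > 0 (depending on v, ρ only), for all large N one slack δ > 0 such that for
every α in the window all δ-near-minimisers of E_α on the torus of side (N/ρ)^{1/3} have
constant-mode occupation ≥ cN. -/
@[route_item "route-AtomisticToContinuum-BECDispersionLadder", crux]
def Target : Prop :=
  ∀ v : ℝ → ENNReal, Literature.MathematicalPhysics.QuantumManyBody.BoseGas.IsRepulsiveFiniteRange v → ∃ ρ₀ : ℝ, 0 < ρ₀ ∧ ∀ ρ : ℝ, 0 < ρ → ρ < ρ₀ → ∃ α₀ : ℝ, α₀ < 2 ∧ ∃ c : ℝ, 0 < c ∧ ∀ᶠ N : ℕ in Filter.atTop, ∃ δ : ENNReal, 0 < δ ∧ ∀ α : ℝ, α₀ < α → α < 2 → ∀ Ψ : Literature.MathematicalPhysics.QuantumManyBody.BoseGas.PeriodicTrialState N (Literature.MathematicalPhysics.QuantumManyBody.BoseGas.sideLength ρ N), (let L : ℝ := Literature.MathematicalPhysics.QuantumManyBody.BoseGas.sideLength ρ N; let E : (Literature.MathematicalPhysics.QuantumManyBody.BoseGas.Config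 N → ℂ) → ENNReal := fun ψ => (∑' p : Fin 3 → ℤ, ENNReal.ofReal ((2 * Real.pi / L * Real.sqrt (∑ k : Fin 3, ((p k : ℤ) : ℝ) ^ 2)) ^ α) * Literature.MathematicalPhysics.QuantumManyBody.BoseGas.cellOccupation N L (fun x : EuclideanSpace ℝ (Fin 3) => ((Real.sqrt (L ^ 3))⁻¹ : ℂ) * Complex.exp (2 * Real.pi * Complex.I * ((∑ k : Fin 3, ((p k : ℤ) : ℝ) * x k : ℝ) : ℂ) / (L : ℂ))) ψ) + ∫⁻ X in Literature.MathematicalPhysics.QuantumManyBody.BoseGas.cellN N L, Literature.MathematicalPhysics.QuantumManyBody.BoseGas.periodicInteraction v L X * (‖ψ X‖₊ : ENNReal) ^ 2; E Ψ.ψ ≤ (⨅ Φ : Literature.MathematicalPhysics.QuantumManyBody.BoseGas.PeriodicTrialState N L, E Φ.ψ) + δ) → ENNReal.ofReal (c * N) ≤ Literature.MathematicalPhysics.QuantumManyBody.BoseGas.condensateOccupation N (Literature.MathematicalPhysics.QuantumManyBody.BoseGas.sideLength ρ N) Ψ.ψ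

/-- item stmt-AtomisticToContinuum-14555 · crux · rank 2 · open · by planner
why it might fail: Open for every fixed α∈(1,2): no U(1)-ordered phase of an interacting continuum Bose gas has been constructed in the thermodynamic limit for any dispersion; the large-field / complex-Gaussian-measure obstruction (Benfatto1994 §1, BFKT2017) is α-independent; hard cores v=⊤ admissible; c uniform in N.
sources: BFKT2017, Benfatto1994, BalabanEtAl2010, CenatiempoGiuliani2014, LiebSeiringerSolovejYngvason2005, Fournais2020
[crux] rung 1 (card item (3) re-aimed per audit): for every FIXED kinetic exponent 1 < α < 2 and
every repulsive finite-range radial v there is ρ₀ > 0 such that for 0 < ρ < ρ₀ there is c > 0 with: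
for all large N there is δ > 0 such that every periodic trial state on the torus of side L =
(N/ρ)^{1/3} with E_α(Ψ) ≤ inf E_α + δ has condensateOccupation ≥ cN (E_α = Σ_p |2πp/L|^α n_Ψ(p) +
periodic interaction, inlined) — thermodynamic-limit ground-state BEC of the d = 3 dilute gas with
dispersion |k|^α, strictly inside the infrared-convergent regime d > 3α/2. [difficulty:
open-problem] -/
@[route_item "route-AtomisticToContinuum-BECDispersionLadder"]
def OpenSideBEC : Prop :=
  ∀ α : ℝ, 1 < α → α < 2 → ∀ v : ℝ → ENNReal, Literature.MathematicalPhysics.QuantumManyBody.BoseGas.IsRepulsiveFiniteRange v → ∃ ρ₀ : ℝ, 0 < ρ₀ ∧ ∀ ρ : ℝ, 0 < ρ → ρ < ρ₀ → ∃ c : ℝ, 0 < c ∧ ∀ᶠ N : ℕ in Filter.atTop, ∃ δ : ENNReal, 0 < δ ∧ ∀ Ψ : Literature.MathematicalPhysics.QuantumManyBody.BoseGas.PeriodicTrialState N (Literature.MathematicalPhysics.QuantumManyBody.BoseGas.sideLength ρ N), (let L : ℝ := Literature.MathematicalPhysics.QuantumManyBody.BoseGas.sideLength ρ N; let E : (Literature.MathematicalPhysics.QuantumManyBody.BoseGas.Config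 N → ℂ) → ENNReal := fun ψ => (∑' p : Fin 3 → ℤ, ENNReal.ofReal ((2 * Real.pi / L * Real.sqrt (∑ k : Fin 3, ((p k : ℤ) : ℝ) ^ 2)) ^ α) * Literature.MathematicalPhysics.QuantumManyBody.BoseGas.cellOccupation N L (fun x : EuclideanSpace ℝ (Fin 3) => ((Real.sqrt (L ^ 3))⁻¹ : ℂ) * Complex.exp (2 * Real.pi * Complex.I * ((∑ k : Fin 3, ((p k : ℤ) : ℝ) * x k : ℝ) : ℂ) / (L : ℂ))) ψ) + ∫⁻ X in Literature.MathematicalPhysics.QuantumManyBody.BoseGas.cellN N L, Literature.MathematicalPhysics.QuantumManyBody.BoseGas.periodicInteraction v L X * (‖ψ X‖₊ : ENNReal) ^ 2; E Ψ.ψ ≤ (⨅ Φ : Literature.MathematicalPhysics.QuantumManyBody.BoseGas.PeriodicTrialState N L, E Φ.ψ) + δ) → ENNReal.ofReal (c * N) ≤ Literature.MathematicalPhysics.QuantumManyBody.BoseGas.condensateOccupation N (Literature.MathematicalPhysics.QuantumManyBody.BoseGas.sideLength ρ N) Ψ.ψ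

/-- item stmt-AtomisticToContinuum-14556 · crux · rank 3 · open · by planner
why it might fail: ¬DialUniformity ↔ OpenSideBEC ∧ ¬Target: false iff the fixed-α condensation constants blow up as α↑2. Nothing known makes n₀-bounds monotone/continuous in α uniformly in N; the only cure of the marginal d=3 flow (Ward identities, Benfatto1994 §3, PistolesiEtAl2004) is order-by-order with n! growth.
sources: Benfatto1994, PistolesiEtAl2004, CastellaniEtAl1997, DupuisRancon2011, LohmannSladeWallace2017, BauerschmidtBrydgesSlade2015LogCorr
[crux] rung 2, "attack the log": OpenSideBEC (for all α ∈ (1,2)) implies X — the condensation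
constants of the α-regularised gases can be chosen uniformly as α ↑ 2: for each small ρ a fixed
window (α₀,2) with c, the slack δ (per N) and the N-threshold independent of α. The marginal (3,2)
infrared problem posed as uniformity in a symmetry- and positivity-preserving analytic regulator.
[deps: OpenSideBEC] [difficulty: open-problem] -/
@[route_item "route-AtomisticToContinuum-BECDispersionLadder"]
def DialUniformity : Prop :=
  (∀ α : ℝ, 1 < α → α < 2 → ∀ v : ℝ → ENNReal, Literature.MathematicalPhysics.QuantumManyBody.BoseGas.IsRepulsiveFiniteRange v → ∃ ρ₀ : ℝ, 0 < ρ₀ ∧ ∀ ρ : ℝ, 0 < ρ → ρ < ρ₀ → ∃ c : ℝ, 0 < c ∧ ∀ᶠ N : ℕ in Filter.atTop, ∃ δ : ENNReal, 0 < δ ∧ ∀ Ψ : Literature.MathematicalPhysics.QuantumManyBody.BoseGas.PeriodicTrialState N (Literature.MathematicalPhysics.QuantumManyBody.BoseGas.sideLength ρ N), (let L : ℝ := Literature.MathematicalPhysics.QuantumManyBody.BoseGas.sideLength ρ N; let E : (Literature.MathematicalPhysics.QuantumManyBody.BoseGas.Config N → ℂ) → ENNReal := fun ψ => (∑' p : Fin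 3 → ℤ, ENNReal.ofReal ((2 * Real.pi / L * Real.sqrt (∑ k : Fin 3, ((p k : ℤ) : ℝ) ^ 2)) ^ α) * Literature.MathematicalPhysics.QuantumManyBody.BoseGas.cellOccupation N L (fun x : EuclideanSpace ℝ (Fin 3) => ((Real.sqrt (L ^ 3))⁻¹ : ℂ) * Complex.exp (2 * Real.pi * Complex.I * ((∑ k : Fin 3, ((p k : ℤ) : ℝ) * x k : ℝ) : ℂ) / (L : ℂ))) ψ) + ∫⁻ X in Literature.MathematicalPhysics.QuantumManyBody.BoseGas.cellN N L, Literature.MathematicalPhysics.QuantumManyBody.BoseGas.periodicInteraction v L X * (‖ψ X‖₊ : ENNReal) ^ 2; E Ψ.ψ ≤ (⨅ Φ : Literature.MathematicalPhysics.QuantumManyBody.BoseGas.PeriodicTrialState N L, E Φ.ψ) + δ) → ENNReal.ofReal (c * N) ≤ Literature.MathematicalPhysics.QuantumManyBody.BoseGas.condensateOccupation N (Literature.MathematicalPhysics.QuantumManyBody.BoseGas.sideLength ρ N) Ψ.ψ) → (∀ v : ℝ → ENNReal, Literature.MathematicalPhysics.QuantumManyBody.BoseGas.IsRepulsiveFiniteRange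 v → ∃ ρ₀ : ℝ, 0 < ρ₀ ∧ ∀ ρ : ℝ, 0 < ρ → ρ < ρ₀ → ∃ α₀ : ℝ, α₀ < 2 ∧ ∃ c : ℝ, 0 < c ∧ ∀ᶠ N : ℕ in Filter.atTop, ∃ δ : ENNReal, 0 < δ ∧ ∀ α : ℝ, α₀ < α → α < 2 → ∀ Ψ : Literature.MathematicalPhysics.QuantumManyBody.BoseGas.PeriodicTrialState N (Literature.MathematicalPhysics.QuantumManyBody.BoseGas.sideLength ρ N), (let L : ℝ := Literature.MathematicalPhysics.QuantumManyBody.BoseGas.sideLength ρ N; let E : (Literature.MathematicalPhysics.QuantumManyBody.BoseGas.Config N → ℂ) → ENNReal := fun ψ => (∑' p : Fin 3 → ℤ, ENNReal.ofReal ((2 * Real.pi / L * Real.sqrt (∑ k : Fin 3, ((p k : ℤ) : ℝ) ^ 2)) ^ α) * Literature.MathematicalPhysics.QuantumManyBody.BoseGas.cellOccupation N L (fun x : EuclideanSpace ℝ (Fin 3) => ((Real.sqrt (L ^ 3))⁻¹ : ℂ) * Complex.exp (2 * Real.pi * Complex.I * ((∑ k : Fin 3, ((p k : ℤ) : ℝ)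 * x k : ℝ) : ℂ) / (L : ℂ))) ψ) + ∫⁻ X in Literature.MathematicalPhysics.QuantumManyBody.BoseGas.cellN N L, Literature.MathematicalPhysics.QuantumManyBody.BoseGas.periodicInteraction v L X * (‖ψ X‖₊ : ENNReal) ^ 2; E Ψ.ψ ≤ (⨅ Φ : Literature.MathematicalPhysics.QuantumManyBody.BoseGas.PeriodicTrialState N L, E Φ.ψ) + δ) → ENNReal.ofReal (c * N) ≤ Literature.MathematicalPhysics.QuantumManyBody.BoseGas.condensateOccupation N (Literature.MathematicalPhysics.QuantumManyBody.BoseGas.sideLength ρ N) Ψ.ψ)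

/-- item stmt-AtomisticToContinuum-0827 · crux · rank 5 · open · by planner
why it might fail: Conjunct-strength, not glue: the hypothesis covers only δ(N)-near-minimisers on the torus (δ ≪ N/L²); the Dirichlet ground state sits a wall term ≫ N/L² higher, so it may never fire. Print transfers e₀ across b.c. (LSSY2005 Ch.2), never λ_max(γ₀); b.c.-sensitive BEC: free gas only (Robinson1976).
sources: LiebSeiringerSolovejYngvason2005, Robinson1976, BoccatoSeiringer2023, Junge2026, LauwersVerbeureZagrebnov2003, Basti2022
[crux] BoundaryTransferWeak (mode-free boundary-condition transfer, per potential): for each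
repulsive finite-range v, PeriodicBEC(v) implies ∃ρ₀>0 ∀ρ∈(0,ρ₀) HasGroundStateBEC v ρ (Dirichlet
ground state, λ_max(γ) ≥ cN via condensateNumber). Not glue: near-minimiser slacks are O(N/L²) while
Dirichlet/periodic energies differ by a boundary term ≫ N/L², so no energy-comparison proof;
expected route: Neumann bracketing of interior sub-boxes (−Δ_Dir ≥ ⊕−Δ_Neu, v ≥ 0) + a mode-free
criterion (λ_max ≥ tr γ²/N). Only the ENERGY analogue is in print (LiebSeiringerSolovejYngvason2005
Ch. 2 after (2.8)). v ≡ 0: hypothesis and conclusion both true. -/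
@[route_item "route-AtomisticToContinuum-BECDispersionLadder", crux]
def BoundaryTransferWeak : Prop :=
  ∀ v : ℝ → ENNReal, Literature.MathematicalPhysics.QuantumManyBody.BoseGas.IsRepulsiveFiniteRange v → (∃ ρ₀ : ℝ, 0 < ρ₀ ∧ ∀ ρ : ℝ, 0 < ρ → ρ < ρ₀ → ∃ c : ℝ, 0 < c ∧ ∀ᶠ N : ℕ in Filter.atTop, ∃ δ : ENNReal, 0 < δ ∧ ∀ Ψ : Literature.MathematicalPhysics.QuantumManyBody.BoseGas.PeriodicTrialState N (Literature.MathematicalPhysics.QuantumManyBody.BoseGas.sideLength ρ N), Literature.MathematicalPhysics.QuantumManyBody.BoseGas.periodicEnergy v Ψ ≤ Literature.MathematicalPhysics.QuantumManyBody.BoseGas.periodicGroundStateEnergy v N (Literature.MathematicalPhysics.QuantumManyBody.BoseGas.sideLength ρ N) + δ → ENNReal.ofReal (c * N) ≤ Literature.MathematicalPhysics.QuantumManyBody.BoseGas.condensateOccupation N (Literature.MathematicalPhysics.QuantumManyBody.BoseGas.sideLength ρ N) Ψ.ψ) → ∃ ρ₀ : ℝ, 0 < ρ₀ ∧ ∀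 ρ : ℝ, 0 < ρ → ρ < ρ₀ → Literature.MathematicalPhysics.QuantumManyBody.BoseGas.HasGroundStateBEC v ρ

/-- item stmt-AtomisticToContinuum-14557 · support · rank 4 · closed · proved by Summit.AtomisticToContinuum.BoseEinsteinCondensation.Theorems.endpointTransfer_proof @ 17d071791247 (prover) · by planner
why it might fail: None known (g3): the g1/g2 Lavrentiev-gap worry is void — a.e. radial slices of H¹ functions are continuous, so the maximal form also vanishes on the essential closure; liminf half = Rellich (3N-torus) + Fatou + C_c^∞ form core for 0≤V∈L¹_loc (Davies1989 Thm 1.8.1) after Hardy cut-offs.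
sources: Davies1989, Dalmaso1993, Kato1966, Hedberg1981, Literature.MathematicalPhysics.QuantumManyBody.BoseGas.limsup_fracPeriodicGroundStateEnergy_le
[crux] rung 3, the endpoint at FIXED volume by energy comparison (repaired): for every admissible v,
N, L > 0, c > 0, α₀ < 2 and slack δ > 0, if for every α ∈ (α₀,2) all δ-near-minimisers of E_α on the
torus of side L have condensateOccupation ≥ cN, then for some δ' > 0 all δ'-near-minimisers of the
ordinary periodicEnergy have condensateOccupation ≥ cN (same c). Mechanism: E_α(Ψ) ≤ E_2(Ψ) +
N·max_{0<k<1}(k^α−k²) (|k|^α ≤ |k|² for |k| ≥ 1, Σ_p n_Ψ(p) = N) and liminf_{α→2⁻} inf E_α ≥ inf E_2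
(Γ-liminf with Rellich compactness in H^{α₀/2} of the 3N-torus), so a δ/3-near-minimiser of E_2 is a
δ-near-minimiser of E_α for α close to 2; no ground-state uniqueness is used. [difficulty: L] -/
@[route_item "route-AtomisticToContinuum-BECDispersionLadder", crux]
def EndpointTransfer : Prop :=
  ∀ v : ℝ → ENNReal, Literature.MathematicalPhysics.QuantumManyBody.BoseGas.IsRepulsiveFiniteRange v → ∀ (N : ℕ) (L : ℝ), 0 < L → ∀ c α₀ : ℝ, 0 < c → α₀ < 2 → ∀ δ : ENNReal, 0 < δ → (∀ α : ℝ, α₀ < α → α < 2 → ∀ Ψ : Literature.MathematicalPhysics.QuantumManyBody.BoseGas.PeriodicTrialState N L, (let E : (Literature.MathematicalPhysics.QuantumManyBody.BoseGas.Config N → ℂ) → ENNReal := fun ψ => (∑' p : Fin 3 → ℤ, ENNReal.ofReal ((2 * Real.pi / L * Real.sqrt (∑ k : Fin 3, ((p k : ℤ) : ℝ) ^ 2)) ^ α) * Literature.MathematicalPhysics.QuantumManyBody.BoseGas.cellOccupation N L (fun x : EuclideanSpace ℝ (Fin 3) => ((Real.sqrt (L ^ 3))⁻¹ : ℂ) *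 Complex.exp (2 * Real.pi * Complex.I * ((∑ k : Fin 3, ((p k : ℤ) : ℝ) * x k : ℝ) : ℂ) / (L : ℂ))) ψ) + ∫⁻ X in Literature.MathematicalPhysics.QuantumManyBody.BoseGas.cellN N L, Literature.MathematicalPhysics.QuantumManyBody.BoseGas.periodicInteraction v L X * (‖ψ X‖₊ : ENNReal) ^ 2; E Ψ.ψ ≤ (⨅ Φ : Literature.MathematicalPhysics.QuantumManyBody.BoseGas.PeriodicTrialState N L, E Φ.ψ) + δ) → ENNReal.ofReal (c * N) ≤ Literature.MathematicalPhysics.QuantumManyBody.BoseGas.condensateOccupation N L Ψ.ψ) → ∃ δ' : ENNReal, 0 < δ' ∧ ∀ Ψ : Literature.MathematicalPhysics.QuantumManyBody.BoseGas.PeriodicTrialState N L, Literature.MathematicalPhysics.QuantumManyBody.BoseGas.periodicEnergy v Ψ ≤ Literature.MathematicalPhysics.QuantumManyBody.BoseGas.periodicGroundStateEnergy v N L + δ' → ENNReal.ofReal (c * N) ≤ Literature.MathematicalPhysics.QuantumManyBody.BoseGas.condensateOccupation N L Ψ.ψ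

-- `EndpointTransfer` holds: proved by `Summit.AtomisticToContinuum.BoseEinsteinCondensation.Theorems.endpointTransfer_proof` @ 17d071791247 (its module imports this route file, so no `_holds` link can be stated here).

/-- item stmt-AtomisticToContinuum-14106 · support · rank 9 · closed · proved by Summit.AtomisticToContinuum.BoseEinsteinCondensation.Theorems.ladderToTarget_proof (prover) · by planner
sources: Benfatto1994, PistolesiEtAl2004, LiebSeiringerSolovejYngvason2005
[glue] the two dial cruxes reach the route target BY NAME: OpenSideBEC (rung 1, fixed-α condensation
on the infrared-convergent side) and DialUniformity (rung 2, α-uniformity of the condensation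
constants as α ↑ 2, stated as OpenSideBEC-body → Target-body with both bodies inlined) together give
Target (X = uniform dial condensation). Pure logic: DialUniformity unfolds definitionally to
OpenSideBEC → Target, so the item is closed by `fun h₁ h₂ => h₂ h₁` (verified against the route
module, lean check rc 0). Filed to make the ladder OpenSideBEC → DialUniformity → Target → (closes,
with EndpointTransfer and BoundaryTransferWeak) → BoseEinsteinCondensation visible in the item graph
(gate lint route.target-unreachable, operator hold 2026-08-16). [deps: OpenSideBEC, DialUniformity,
Target] [difficulty: provable-now] -/
@[route_item "route-AtomisticToContinuum-BECDispersionLadder"]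
def LadderToTarget : Prop :=
  OpenSideBEC → DialUniformity → Target

-- `LadderToTarget` holds: proved by `Summit.AtomisticToContinuum.BoseEinsteinCondensation.Theorems.ladderToTarget_proof` (its module imports this route file, so no `_holds` link can be stated here).

/-- item stmt-AtomisticToContinuum-14558 · support · rank 9 · closed · proved by Summit.AtomisticToContinuum.BoseEinsteinCondensation.Theorems.fracEnergyAtTwo_proof (prover) · by planner
sources: LiebSeiringerSolovejYngvason2005, Fournais2020
[support] consistency of the inlined α-energy with the library at the endpoint: for α = 2 and every
periodic trial state Ψ on a torus of side L > 0, E_2(Ψ) = periodicEnergy v Ψ (Parseval for ∇Ψ on the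
3-torus in the traced variable, Tonelli, Bose symmetry: Σ_p |2πp/L|² n_Ψ(p) = ∫_{cell^N} Σᵢ|∇ᵢΨ|²).
[difficulty: M] -/
@[route_item "route-AtomisticToContinuum-BECDispersionLadder"]
def FracEnergyAtTwo : Prop :=
  ∀ (v : ℝ → ENNReal) (N : ℕ) (L : ℝ), 0 < L → ∀ Ψ : Literature.MathematicalPhysics.QuantumManyBody.BoseGas.PeriodicTrialState N L, (let E : (Literature.MathematicalPhysics.QuantumManyBody.BoseGas.Config N → ℂ) → ENNReal := fun ψ => (∑' p : Fin 3 → ℤ, ENNReal.ofReal ((2 * Real.pi / L * Real.sqrt (∑ k : Fin 3, ((p k : ℤ) : ℝ) ^ 2)) ^ (2 : ℝ)) * Literature.MathematicalPhysics.QuantumManyBody.BoseGas.cellOccupation N L (fun x : EuclideanSpace ℝ (Fin 3) => ((Real.sqrt (L ^ 3))⁻¹ : ℂ) * Complex.exp (2 * Real.pi * Complex.I * ((∑ k : Fin 3, ((p k : ℤ) : ℝ) * x k : ℝ) : ℂ) / (L : ℂ))) ψ) + ∫⁻ X in Literature.MathematicalPhysics.QuantumManyBody.BoseGas.cellN N L,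 Literature.MathematicalPhysics.QuantumManyBody.BoseGas.periodicInteraction v L X * (‖ψ X‖₊ : ENNReal) ^ 2; E Ψ.ψ) = Literature.MathematicalPhysics.QuantumManyBody.BoseGas.periodicEnergy v Ψ

-- `FracEnergyAtTwo` holds: proved by `Summit.AtomisticToContinuum.BoseEinsteinCondensation.Theorems.fracEnergyAtTwo_proof` (its module imports this route file, so no `_holds` link can be stated here).

/-- item stmt-AtomisticToContinuum-14559 · support · rank 9 · closed · proved by Summit.AtomisticToContinuum.BoseEinsteinCondensation.Theorems.occupationSumRule_proof @ 9601316729d7 (prover) · by planner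
sources: LiebSeiringerSolovejYngvason2005, Fournais2020
[support] the plane-wave occupations of a periodic trial state sum to N: Σ_{p∈ℤ³} n_Ψ(p) = N for
every periodic trial state on a torus of side L > 0 (Parseval in the traced variable: the plane
waves L^{-3/2}e^{2πip·x/L} are an orthonormal basis of L²(cell), tr γ_Ψ = N) — the input of
EndpointTransfer's comparison E_α ≤ E_2 + N·max_{0<k<1}(k^α − k²). [difficulty: M] -/
@[route_item "route-AtomisticToContinuum-BECDispersionLadder"]
def OccupationSumRule : Prop :=
  ∀ (N : ℕ) (L : ℝ), 0 < L → ∀ Ψ : Literature.MathematicalPhysics.QuantumManyBody.BoseGas.PeriodicTrialState N L, (∑' p : Fin 3 → ℤ, Literature.MathematicalPhysics.QuantumManyBody.BoseGas.cellOccupation N L (fun x : EuclideanSpace ℝ (Fin 3) => ((Real.sqrt (L ^ 3))⁻¹ : ℂ) * Complex.exp (2 * Real.pi * Complex.I * ((∑ k : Fin 3, ((p k : ℤ) : ℝ) * x k : ℝ) : ℂ) / (L : ℂ))) Ψ.ψ) = (N : ENNReal)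

-- `OccupationSumRule` holds: proved by `Summit.AtomisticToContinuum.BoseEinsteinCondensation.Theorems.occupationSumRule_proof` @ 9601316729d7 (its module imports this route file, so no `_holds` link can be stated here).

/-- item stmt-AtomisticToContinuum-14560 · support · rank 9 · closed · proved by Summit.AtomisticToContinuum.BoseEinsteinCondensation.Theorems.dialPowerCounting_proof (prover) · by planner
sources: Literature.Barriers.AtomisticToContinuum.BogoliubovPerturbationInfrared, DupuisRancon2011, FisherMaNickel1972
[support] the marginality certificate of the card (deliverable (ii)) in the barrier's own vocabulary
(FreqMomentum 3, spatialSq): for every α > 0 the one-loop bubble of two dial propagators 1/(k₀² +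
|𝐤|^α), i.e. ((k₀² + (|𝐤|²)^{α/2})⁻¹)², is integrable on the unit infrared ball of ℝ^{1+3} iff α < 2
(k₀-integral ≍ |𝐤|^{-3α/2}, then ∫₀¹ q^{2−3α/2}dq). α = 2 is the catalogued log divergence
(not_integrableOn_bubbleIntegrand, d = 3); α < 2 is the open side. [difficulty: provable-now] -/
@[route_item "route-AtomisticToContinuum-BECDispersionLadder"]
def DialPowerCounting : Prop :=
  ∀ α : ℝ, 0 < α → (MeasureTheory.IntegrableOn (fun k : Literature.Barriers.AtomisticToContinuum.BoseGas.FreqMomentum 3 => ((k 0) ^ 2 + (Literature.Barriers.AtomisticToContinuum.BoseGas.spatialSq k) ^ (α / 2))⁻¹ ^ 2) (Metric.ball (0 : Literature.Barriers.AtomisticToContinuum.BoseGas.FreqMomentum 3) 1) ↔ α < 2)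

-- `DialPowerCounting` holds: proved by `Summit.AtomisticToContinuum.BoseEinsteinCondensation.Theorems.dialPowerCounting_proof` (its module imports this route file, so no `_holds` link can be stated here).

/-- item stmt-AtomisticToContinuum-14561 · assembly · rank 1 · closed · proved by Summit.AtomisticToContinuum.BoseEinsteinCondensation.Theorems.becDispersionLadder_assembly_proof (prover) · by planner
sources: LiebSeiringerSolovejYngvason2005, Fournais2020
[assembly] OpenSideBEC → DialUniformity → EndpointTransfer → BoundaryTransferWeak →
BoseEinsteinCondensation (the audited sub-problem Statement decl `_root_.BoseEinsteinCondensation`,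
by name; D-0027 §2.1). -/
@[route_item "route-AtomisticToContinuum-BECDispersionLadder"]
def Assembly : Prop :=
  OpenSideBEC → DialUniformity → EndpointTransfer → BoundaryTransferWeak → _root_.BoseEinsteinCondensation

-- `Assembly` holds: proved by `Summit.AtomisticToContinuum.BoseEinsteinCondensation.Theorems.becDispersionLadder_assembly_proof` (its module imports this route file, so no `_holds` link can be stated here).

/-! D-0027 §2.1 — DECIDING THEOREM (planner-authored via `route open/edit --closes-file`; by planner-rbadge-AtomisticToContinuum-BECDispers-7cb6fe81-0 2026-08-15T20:08:50Z):
its hypotheses are this route's items and its conclusion the sub-problem Statement (glue_lint), and it elaborates with this file. -/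

@[closes "route-AtomisticToContinuum-BECDispersionLadder"] theorem closes (h₀ : Target) (h₄ : EndpointTransfer) (h₅ : BoundaryTransferWeak) :
    _root_.BoseEinsteinCondensation := by
  intro v hv
  obtain ⟨ρ₀, hρ₀, hX⟩ := h₀ v hv
  refine h₅ v hv ⟨ρ₀, hρ₀, fun ρ hρ hρ' => ?_⟩
  obtain ⟨α₀, hα₀, c, hc, hN⟩ := hX ρ hρ hρ'
  refine ⟨c, hc, ?_⟩
  -- the torus side (N/ρ)^{1/3} is positive for N ≥ 1, which EndpointTransfer needs at the fixed final volume
  have hL : ∀ᶠ N : ℕ in Filter.atTop,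
      0 < Literature.MathematicalPhysics.QuantumManyBody.BoseGas.sideLength ρ N := by
    filter_upwards [Filter.eventually_gt_atTop 0] with N hN
    exact Real.rpow_pos_of_pos (div_pos (Nat.cast_pos.2 hN) hρ) _
  filter_upwards [hN, hL] with N hNδ hLN
  obtain ⟨δ, hδ, hα⟩ := hNδ
  -- uniform-in-α dial condensation at (N, L) with one slack δ ⇒ periodic BEC at (N, L) by energy comparison
  exact h₄ v hv N _ hLN c α₀ hc hα₀ δ hδ hα

end Summit.AtomisticToContinuum.BoseEinsteinCondensation.Theses.BECDispersionLadder
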